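import Mathlib.LinearAlgebra.Matrix.Rank
import Mathlib.LinearAlgebra.FiniteDimensional.Lemmas
import Mathlib.LinearAlgebra.Matrix.BilinearForm
import Mathlib.Algebra.Field.ZMod
import Mathlib.Data.Nat.Prime.Int
import Mathlib.Algebra.BigOperators.Fin
import Mathlib.Algebra.BigOperators.Associated
import HarnessLib

/-!
# `p`-adically unimodular orthogonal frames of an integral quadratic form (`p` odd)

Topic `NumberTheory/QuadraticForms`; namespace `Literature.NumberTheory.QuadraticForms`. Everything
here is proved.

Let `G` be a symmetric integer matrix of size `n` with `p ∤ det G`, `p` an odd prime, and let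
`B(x, y) = ᵗx G y` be its bilinear form on `ℤⁿ` (`Matrix.toBilin' G`). We construct `n` pairwise
`B`-orthogonal integer vectors whose squares `B(vᵢ, vᵢ)` are all prime to `p`
(`exists_orthogonalFamily_not_dvd`). This is the integral shadow of the classical fact that a
unimodular quadratic `ℤₚ`-lattice, `p ≠ 2`, has an orthogonal basis of units — the splitting of
`E ⊗ ℤₚ` "in an orthogonal direct sum of `ℤₚ`-modules of rank `1`" by which Serre computes
`εₚ(E) = 1` (*A Course in Arithmetic*, Ch. V §1.3.6; Cassels, *Rational Quadratic Forms*, Ch. 8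
Lemma 3.1/Thm. 3.1) — carried out inside `ℤⁿ` with denominators cleared, so that no `p`-adic
numbers are needed: given `r < n` such vectors `e₁, …, e_r`, the integral projection
`π(x) = D x - ∑ᵢ D'ᵢ B(x, eᵢ) eᵢ` (`D = ∏ B(eᵢ,eᵢ)`, `D'ᵢ = D / B(eᵢ,eᵢ)`) maps `ℤⁿ` into the
orthogonal complement of the `eᵢ`, and `B(πx, πy) = D · Φ(x, y)` with
`Φ(x,y) = D B(x,y) - ∑ᵢ D'ᵢ B(x,eᵢ) B(eᵢ,y)`; if all `Φ(x, y)` were divisible by `p`, then modulo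
`p` the invertible matrix `D G` would be a sum of `r < n` matrices of rank `≤ 1` — absurd; and
from `p ∤ B(πx, πy)` one of `πx, πy, πx + πy` has square prime to `p` (`p` odd).

## References

* J.-P. Serre, *A Course in Arithmetic*, GTM 7, Springer 1973, Ch. V §1.3.6 (PDF p. 46).
  [Serre1973]
* J. W. S. Cassels, *Rational Quadratic Forms*, Academic Press 1978, Ch. 8 §3 (unimodular
  `ℤₚ`-lattices, `p ≠ 2`, are diagonalisable).
-/

namespace Literature.NumberTheory.QuadraticForms

open Finset Matrix

/-! ### Sub-additivity of matrix rank (Mathlib has `rank_mul_le` but not `rank_add_le`) -/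

section Rank

variable {F : Type*} [Field F] {m k : Type*} [Fintype k]

/-- Sub-additivity of the rank of matrices over a field: `rank (A + B) ≤ rank A + rank B`
(the range of `A + B` lies in the sum of the ranges). Same statement as
`Literature.Computability.AlgebraicComplexity.matrix_rank_add_le` (rank-method barriers file,
not imported into this arithmetic file; both are candidates for a hoist). [folklore] -/
theorem matrixRank_add_le (A B : Matrix m k F) : (A + B).rank ≤ A.rank + B.rank := by
  unfold Matrix.rank
  rw [Matrix.mulVecLin_add]
  calc Module.finrank F ↥(LinearMap.range (A.mulVecLin + B.mulVecLin))
      ≤ Module.finrank F ↥(LinearMap.range A.mulVecLin ⊔ LinearMap.range B.mulVecLin) :=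
        Submodule.finrank_mono (LinearMap.range_add_le _ _)
    _ ≤ _ := Submodule.finrank_add_le_finrank_add_finrank _ _

/-- Sub-additivity of matrix rank over finite sums. [folklore] -/
theorem matrixRank_sum_le {ι : Type*} (s : Finset ι) (A : ι → Matrix m k F) :
    (∑ i ∈ s, A i).rank ≤ ∑ i ∈ s, (A i).rank := by
  classical
  induction s using Finset.induction_on with
  | empty => simp
  | insert a s ha ih =>
    rw [Finset.sum_insert ha, Finset.sum_insert ha]
    exact (matrixRank_add_le _ _).trans (by gcongr)

end Rank

/-! ### One more orthogonal vector of square prime to `p` -/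

variable {p : ℕ} [hp : Fact p.Prime]

include hp

/-- The reduction of an integer matrix with determinant prime to `p` is invertible over `𝔽ₚ`,
hence has rank `n`; so does any nonzero scalar multiple. [folklore] -/
theorem rank_smul_map_eq_of_not_dvd_det {n : ℕ} {G : Matrix (Fin n) (Fin n) ℤ}
    (hdet : ¬ (p : ℤ) ∣ G.det) {D : ℤ} (hD : ¬ (p : ℤ) ∣ D) :
    ((D : ZMod p) • G.map (Int.castRingHom (ZMod p))).rank = n := by
  have hunit : IsUnit ((D : ZMod p) • G.map (Int.castRingHom (ZMod p))) := by
    rw [Matrix.isUnit_iff_isUnit_det, Matrix.det_smul, Fintype.card_fin]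
    have h1 : (D : ZMod p) ≠ 0 := by rwa [Ne, ZMod.intCast_zmod_eq_zero_iff_dvd]
    have h2 : (G.map (Int.castRingHom (ZMod p))).det ≠ 0 := by
      rw [← RingHom.mapMatrix_apply, ← RingHom.map_det, eq_intCast, Ne,
        ZMod.intCast_zmod_eq_zero_iff_dvd]
      exact hdet
    exact (mul_ne_zero (pow_ne_zero n h1) h2).isUnit
  simpa using Matrix.rank_of_isUnit _ hunit

/-- **Extension step** (`p` odd). Let `e₁, …, e_r` (`r < n`) be pairwise orthogonal integer
vectors with squares prime to `p`, for the form `B = ᵗx G y` of a symmetric integer matrix `G`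
with `p ∤ det G`. Then there is an integer vector orthogonal to all `eᵢ` whose square is prime to
`p`: the unimodular `ℤ₍ₚ₎`-lattice splits off the `eᵢ` orthogonally and the complement is again
unimodular, hence represents a unit (Serre, Ch. V §1.3.6; Cassels, *Rational Quadratic Forms*,
Ch. 8 Lemma 3.1) — here via the integral projection `π` and a rank count modulo `p`.
[cite: Serre1973, Ch. V §1.3.6] -/
theorem exists_orthogonal_not_dvd (hp2 : p ≠ 2) {n : ℕ} {G : Matrix (Fin n) (Fin n) ℤ}
    (hG : G.IsSymm) (hdet : ¬ (p : ℤ) ∣ G.det) {r : ℕ} (hr : r < n) (e : Fin r → (Fin n → ℤ))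
    (hortho : ∀ i j, i ≠ j → Matrix.toBilin' G (e i) (e j) = 0)
    (hunit : ∀ i, ¬ (p : ℤ) ∣ Matrix.toBilin' G (e i) (e i)) :
    ∃ z : Fin n → ℤ, (∀ i, Matrix.toBilin' G z (e i) = 0) ∧ ¬ (p : ℤ) ∣ Matrix.toBilin' G z z := by
  have hpp : Prime (p : ℤ) := Nat.prime_iff_prime_int.mp hp.out
  set B := Matrix.toBilin' G with hB
  have hBs : B.IsSymm := Matrix.isSymm_toBilin'_iff_isSymm.mpr hG
  -- `D = ∏ B(eᵢ,eᵢ)`, `D'ᵢ = ∏_{j ≠ i} B(eⱼ,eⱼ)` (made opaque: only `D'ᵢ B(eᵢ,eᵢ) = D`, `p ∤ D` matter)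
  obtain ⟨D, D', hD'N, hpD⟩ : ∃ (D : ℤ) (D' : Fin r → ℤ),
      (∀ i, D' i * B (e i) (e i) = D) ∧ ¬ (p : ℤ) ∣ D := by
    refine ⟨∏ i, B (e i) (e i), fun i => ∏ j ∈ univ.erase i, B (e j) (e j),
      fun i => Finset.prod_erase_mul _ _ (mem_univ i), fun h => ?_⟩
    obtain ⟨i, -, hi⟩ := hpp.exists_mem_finset_dvd h
    exact hunit i hi
  -- the integral projection onto the orthogonal complement of the `eᵢ` (opaque, with its formula)
  obtain ⟨π, hπ⟩ : ∃ π : (Fin n → ℤ) → (Fin n → ℤ),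
      ∀ x, π x = D • x - ∑ i, (D' i * B x (e i)) • e i := ⟨_, fun x => rfl⟩
  have hπ_left : ∀ x y, B (π x) y = D * B x y - ∑ i, D' i * B x (e i) * B (e i) y := by
    intro x y
    rw [hπ x]
    simp only [map_sub, map_smul, map_sum, LinearMap.sub_apply, LinearMap.smul_apply,
      LinearMap.sum_apply, smul_eq_mul]
  have hπ_ortho : ∀ x k, B (π x) (e k) = 0 := by
    intro x k
    rw [hπ_left, Finset.sum_eq_single k (fun i _ hik => by rw [hortho i k hik, mul_zero])
      (fun h => absurd (mem_univ k) h), ← hD'N k]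
    ring
  have hΦ : ∀ x y, B (π x) (π y) = D * B (π x) y := by
    intro x y
    conv_lhs => rw [hπ y]
    rw [map_sub, map_smul, map_sum, smul_eq_mul]
    simp only [map_smul, smul_eq_mul, hπ_ortho, mul_zero, Finset.sum_const_zero, sub_zero]
  -- pairing with coordinate vectors
  have hBsingle : ∀ a i, B (Pi.single a 1) (e i) = (G *ᵥ e i) a := fun a i => by
    rw [hB, Matrix.toBilin'_apply', single_dotProduct, one_mul]
  have hBsingle' : ∀ i b, B (e i) (Pi.single b 1) = (G *ᵥ e i) b := fun i b => by
    rw [hBs.eq, hBsingle]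
  have hBss : ∀ a b, B (Pi.single a 1) (Pi.single b 1) = G a b := Matrix.toBilin'_single G
  refine Classical.by_contradiction fun hall => ?_
  push Not at hall
  -- Step 1: every `Φ(δ_a, δ_b)` is divisible by `p`
  have hdiv : ∀ a b, (p : ℤ) ∣ D * G a b - ∑ i, D' i * (G *ᵥ e i) a * (G *ᵥ e i) b := by
    intro a b
    refine Classical.by_contradiction fun hab => ?_
    have hXY : ¬ (p : ℤ) ∣ B (π (Pi.single a 1)) (π (Pi.single b 1)) := by
      rw [hΦ, hπ_left]
      simp only [hBsingle, hBsingle', hBss]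
      exact fun h => (hpp.dvd_or_dvd h).elim hpD hab
    have hXX := hall _ (hπ_ortho (Pi.single a 1))
    have hYY := hall _ (hπ_ortho (Pi.single b 1))
    have hS := hall (π (Pi.single a 1) + π (Pi.single b 1)) fun i => by
      rw [map_add, LinearMap.add_apply, hπ_ortho, hπ_ortho, add_zero]
    have h2 : (p : ℤ) ∣ 2 * B (π (Pi.single a 1)) (π (Pi.single b 1)) := by
      have h := dvd_sub (dvd_sub hS hXX) hYY
      have hexp : B (π (Pi.single a 1) + π (Pi.single b 1)) (π (Pi.single a 1) + π (Pi.single b 1))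
          - B (π (Pi.single a 1)) (π (Pi.single a 1)) - B (π (Pi.single b 1)) (π (Pi.single b 1))
          = 2 * B (π (Pi.single a 1)) (π (Pi.single b 1)) := by
        simp only [map_add, LinearMap.add_apply]
        rw [hBs.eq (π (Pi.single b 1)) (π (Pi.single a 1))]
        ring
      rwa [hexp] at h
    rcases hpp.dvd_or_dvd h2 with h | h
    · have h' : (p : ℤ) ∣ ((2 : ℕ) : ℤ) := by simpa using h
      rw [Int.natCast_dvd_natCast] at h'
      exact hp2 ((Nat.prime_dvd_prime_iff_eq hp.out Nat.prime_two).mp h')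
    · exact hXY h
  -- Step 2: modulo `p`, `D G` would be a sum of `r < n` matrices of rank `≤ 1`
  obtain ⟨u, hu⟩ : ∃ u : Fin r → Fin n → ZMod p, ∀ i a, u i a = (((G *ᵥ e i) a : ℤ) : ZMod p) :=
    ⟨_, fun i a => rfl⟩
  have hmat : (D : ZMod p) • G.map (Int.castRingHom (ZMod p)) =
      ∑ i, Matrix.vecMulVec ((D' i : ZMod p) • u i) (u i) := by
    ext a b
    have h := (ZMod.intCast_zmod_eq_zero_iff_dvd _ p).mpr (hdiv a b)
    push_cast at h
    rw [sub_eq_zero] at h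
    simp only [Matrix.smul_apply, Matrix.map_apply, eq_intCast, Matrix.sum_apply,
      Matrix.vecMulVec_apply, Pi.smul_apply, smul_eq_mul, hu, h]
  have hrank := rank_smul_map_eq_of_not_dvd_det hdet hpD
  rw [hmat] at hrank
  have hle : (∑ i, Matrix.vecMulVec ((D' i : ZMod p) • u i) (u i)).rank ≤ r :=
    calc (∑ i, Matrix.vecMulVec ((D' i : ZMod p) • u i) (u i)).rank
        ≤ ∑ i, (Matrix.vecMulVec ((D' i : ZMod p) • u i) (u i)).rank := matrixRank_sum_le _ _
      _ ≤ ∑ _i : Fin r, 1 := sum_le_sum fun i _ => Matrix.rank_vecMulVec_le _ _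
      _ = r := by simp
  exact lt_irrefl _ ((hle.trans_lt hr).trans_eq hrank.symm)

/-- **`p`-adically unimodular orthogonal frames** (`p` odd): for a symmetric integer matrix `G` of
size `n` with `p ∤ det G` there are `n` pairwise orthogonal integer vectors whose squares
`ᵗvᵢ G vᵢ` are all prime to `p` — an orthogonal basis of units of the unimodular `ℤ₍ₚ₎`-lattice
`ℤ₍ₚ₎ⁿ` realised by integer vectors (Serre, Ch. V §1.3.6: `E ⊗ ℤₚ` splits into rank-one pieces
for `p ≠ 2`, whence `εₚ(E) = 1`; Cassels, *Rational Quadratic Forms*, Ch. 8 Thm. 3.1).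
[cite: Serre1973, Ch. V §1.3.6] -/
theorem exists_orthogonalFamily_not_dvd (hp2 : p ≠ 2) {n : ℕ} {G : Matrix (Fin n) (Fin n) ℤ}
    (hG : G.IsSymm) (hdet : ¬ (p : ℤ) ∣ G.det) :
    ∃ v : Fin n → (Fin n → ℤ), (∀ i j, i ≠ j → Matrix.toBilin' G (v i) (v j) = 0) ∧
      ∀ i, ¬ (p : ℤ) ∣ Matrix.toBilin' G (v i) (v i) := by
  have hBs : (Matrix.toBilin' G).IsSymm := Matrix.isSymm_toBilin'_iff_isSymm.mpr hG
  suffices h : ∀ r, r ≤ n → ∃ v : Fin r → (Fin n → ℤ),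
      (∀ i j, i ≠ j → Matrix.toBilin' G (v i) (v j) = 0) ∧
        ∀ i, ¬ (p : ℤ) ∣ Matrix.toBilin' G (v i) (v i) from h n le_rfl
  intro r
  induction r with
  | zero => exact fun _ => ⟨Fin.elim0, fun i => i.elim0, fun i => i.elim0⟩
  | succ r ih =>
    intro hr
    obtain ⟨v, ho, hu⟩ := ih (Nat.le_of_succ_le hr)
    obtain ⟨z, hz, hzz⟩ := exists_orthogonal_not_dvd hp2 hG hdet hr v ho hu
    refine ⟨Fin.cons z v, fun i j hij => ?_, fun i => ?_⟩
    · induction i using Fin.cases with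
      | zero =>
        induction j using Fin.cases with
        | zero => exact absurd rfl hij
        | succ j => simp only [Fin.cons_zero, Fin.cons_succ]; exact hz j
      | succ i =>
        induction j using Fin.cases with
        | zero => simp only [Fin.cons_zero, Fin.cons_succ]; rw [hBs.eq]; exact hz i
        | succ j =>
          simp only [Fin.cons_succ]
          exact ho i j fun h => hij (congrArg Fin.succ h)
    · induction i using Fin.cases with
      | zero => simpa only [Fin.cons_zero] using hzz
      | succ i => simpa only [Fin.cons_succ] using hu i

end Literature.NumberTheory.QuadraticForms
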